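import Literature.AlgebraicGeometry.Resolution.LogRegularAtlasGluing
import Literature.AlgebraicGeometry.Resolution.LogRegularScheme
import Literature.AlgebraicGeometry.Resolution.BlowupResolutionChartGlue
import HarnessLib

/-!
# The two renderings of a log regular Zariski fs atlas agree (Kato 1994 (1.5), Def. (2.1), (10.4))

Topic: `Literature/AlgebraicGeometry/Resolution`. The tree vendors Kato's condition (S) of (1.5)
("`X` is covered by open sets `U_λ` with charts `P_λ → M|_{U_λ}` by fs monoids") together with
logarithmic regularity (Def. (2.1)) at every point in TWO vocabularies, each with its own copy of
the several-charts resolution theorem (10.4) as a named fact: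

* `LogRegularAtlas X` (`LogRegularAtlas.lean`): finitely many AFFINE chart domains, regularity as
  `LogChart.IsLogRegularAt` at every prime of `Γ(X, U_i)`, compatibility as EQUALITY of the stalk
  monoids `𝒪^×_{X,x} · φ_i(P_i) ⊆ 𝒪_{X,x}` (`chartStalkMonoid`); named fact
  `Kato1994_logRegular_hasResolution_general` (stub of record of the crux `DescentPerfectToAll`,
  also 0554 / 0557);
* `LogAtlas X` with `LogAtlas.IsLogRegular` (`LogRegularScheme.lean`): finitely many arbitrary
  open chart domains, regularity as `LogChart.IsLogRegularLocal` for the stalk charts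
  `P_i → 𝒪_{X,x}`, compatibility ELEMENTWISE (every germ `φ_i(p)_x` is associated to some
  `φ_j(q)_x`, `LogAtlas.chart_compatible`), plus `X` locally Noetherian; named fact
  `Kato1994_logRegularScheme_hasResolution` (for quasi-compact `X`; consumed by the route
  `RadicialJung`, crux `CleanModelsSuffice`).

This file PROVES that the two renderings are interchangeable and the two named facts equivalent,
so that one discharge (fan subdivision + chart regularity, cf.
`Kato1994_logRegular_hasResolution_general_of_charts` in `BlowupResolutionChartGlue.lean`)
settles both:

* `chartStalkMonoid_comp_map` (restricting a chart to a smaller open keeps its stalk monoids),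
  `chartStalkMonoid_le_of_forall_associated` / `exists_associated_of_chartStalkMonoid_le`
  (elementwise compatibility ⇔ inclusion of stalk monoids), `LogAtlas.chartStalkMonoid_eq`;
* `LogRegularAtlas.isLogRegular_scheme`, `LogRegularAtlas.compactSpace` — a `LogRegularAtlas` IS a
  log regular `LogAtlas` on a quasi-compact scheme (built with the same charts) (regularity transported by
  `LogAtlas.isLogRegularLocal_stalkChart_iff`, locally Noetherian from the Noetherian affine
  cover);
* `LogAtlas.IsLogRegular.nonempty_logRegularAtlas` — conversely, on a quasi-compact scheme a log
  regular `LogAtlas` yields a `LogRegularAtlas`: prescribe the stalk monoids of the given charts,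
  restrict the charts to affine neighbourhoods (primes of `Γ(X, V)` are points of `V`), glue
  finitely many by `logRegularAtlas_of_localLogRegularChart` (`LogRegularAtlasGluing.lean`);
  `nonempty_logRegularAtlas_iff : Nonempty (LogRegularAtlas X) ↔ CompactSpace X ∧ Scheme.IsLogRegular X`;
* `Kato1994_logRegularScheme_hasResolution_iff_general` — the two named facts are EQUIVALENT;
  `Kato1994_logRegularScheme_hasResolution_of_charts` — hence the `LogAtlas` fact, too, follows
  from the chart statement `H` of `Kato1994_logRegular_hasResolution_general_of_charts`.

## What is NOT here

No proof of either named fact (no fans, no subdivision); no étale charts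
(`LogRegularSchemeEtale.lean` is a different, more general rendering, not compared here).

## Sources (text read: Kato pp. 1075–1076, 1089–1092)

* [Kato1994] K. Kato, *Toric singularities*, Amer. J. Math. 116 (1994) 1073–1099: (1.5) condition
  (S), (1.6), Def. (2.1), (10.4) with (9.8), (9.11), (10.3).
* [Niziol2006] W. Nizioł, *Toric singularities: log-blow-ups and global resolutions*,
  J. Algebraic Geom. 15 (2006): §2.1, Lemma 2.4 (1) (for log regular structures `M_x → 𝒪_{X,x}`
  is injective, so two charts define the same log structure iff their stalk monoids in `𝒪_{X,x}`
  agree — the reason the two compatibility conditions are the faithful ones), Thm. 5.8.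
-/

noncomputable section

open AlgebraicGeometry CategoryTheory TopologicalSpace Opposite

namespace Literature.AlgebraicGeometry.Resolution

universe u w

/-! ## Stalk monoids: restricted charts, and compatibility in the two currencies -/

section StalkMonoid

variable {X : Scheme.{u}}

/-- Restricting a chart `φ : P → Γ(X, U)` to a smaller open `V ⊆ U` does not change its stalk
monoids at the points of `V` (germs factor through restriction). [cite: Kato1994, (1.5)–(1.6)] -/
theorem chartStalkMonoid_comp_map {U V : X.Opens} (hVU : V ≤ U) {P : Type*} [MulOneClass P]
    (φ : P →* Γ(X, U)) (x : X) (hx : x ∈ V) :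
    chartStalkMonoid V ((X.presheaf.map (homOfLE hVU).op).hom.toMonoidHom.comp φ) x hx =
      chartStalkMonoid U φ x (hVU hx) := by
  have hc : (X.presheaf.germ V x hx).hom.toMonoidHom.comp
      (X.presheaf.map (homOfLE hVU).op).hom.toMonoidHom =
        (X.presheaf.germ U x (hVU hx)).hom.toMonoidHom :=
    MonoidHom.ext fun s => TopCat.Presheaf.germ_res_apply X.presheaf (homOfLE hVU) x hx s
  rw [chartStalkMonoid, chartStalkMonoid, ← MonoidHom.map_mrange, Submonoid.map_map, hc]

/-- **From Kato's elementwise compatibility to the inclusion of stalk monoids**: if every germ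
`φ(p)_x` is a unit multiple of some germ `φ'(q)_x`, then the stalk monoid of the chart `φ` at `x`
(units of `𝒪_{X,x}` together with the germs of `φ(P)`) is contained in that of `φ'`.
[cite: Kato1994, (1.5)–(1.6)] -/
theorem chartStalkMonoid_le_of_forall_associated {U U' : X.Opens} {P P' : Type*} [MulOneClass P]
    [MulOneClass P'] (φ : P →* Γ(X, U)) (φ' : P' →* Γ(X, U')) (x : X) (hx : x ∈ U)
    (hx' : x ∈ U')
    (h : ∀ p : P, ∃ q : P', Associated (X.presheaf.germ U x hx (φ p))
      (X.presheaf.germ U' x hx' (φ' q))) :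
    chartStalkMonoid U φ x hx ≤ chartStalkMonoid U' φ' x hx' := by
  refine sup_le le_sup_left ?_
  rintro _ ⟨_, ⟨p, rfl⟩, rfl⟩
  obtain ⟨q, u, hu⟩ := h p
  have hrew : (X.presheaf.germ U x hx).hom.toMonoidHom (φ p) =
      (↑u⁻¹ : X.presheaf.stalk x) * X.presheaf.germ U' x hx' (φ' q) := by
    rw [← hu, mul_comm, Units.mul_inv_cancel_right]
    rfl
  rw [hrew]
  exact Submonoid.mul_mem_sup ((IsUnit.mem_submonoid_iff _).2 (Units.isUnit u⁻¹))
    ⟨_, ⟨q, rfl⟩, rfl⟩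

/-- **From the inclusion of stalk monoids to Kato's elementwise compatibility**: if the stalk
monoid of `φ` at `x` is contained in that of `φ'`, every germ `φ(p)_x` is associated to some germ
`φ'(q)_x`. [cite: Kato1994, (1.5)–(1.6)] -/
theorem exists_associated_of_chartStalkMonoid_le {U U' : X.Opens} {P P' : Type*} [MulOneClass P]
    [MulOneClass P'] (φ : P →* Γ(X, U)) (φ' : P' →* Γ(X, U')) (x : X) (hx : x ∈ U)
    (hx' : x ∈ U') (h : chartStalkMonoid U φ x hx ≤ chartStalkMonoid U' φ' x hx') (p : P) :
    ∃ q : P', Associated (X.presheaf.germ U x hx (φ p)) (X.presheaf.germ U' x hx' (φ' q)) := by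
  have hmem : (X.presheaf.germ U x hx).hom.toMonoidHom (φ p) ∈ chartStalkMonoid U' φ' x hx' :=
    h (Submonoid.mem_sup_right ⟨_, ⟨p, rfl⟩, rfl⟩)
  obtain ⟨y, hy, z, hz, hyz⟩ := Submonoid.mem_sup.1 hmem
  obtain ⟨_, ⟨q, rfl⟩, rfl⟩ := hz
  obtain ⟨v, rfl⟩ := (IsUnit.mem_submonoid_iff _).1 hy
  refine ⟨q, v⁻¹, ?_⟩
  change (X.presheaf.germ U x hx).hom.toMonoidHom (φ p) * ↑v⁻¹ =
    (X.presheaf.germ U' x hx').hom.toMonoidHom (φ' q)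
  rw [← hyz, mul_comm, Units.inv_mul_cancel_left]

/-- **The two compatibility conditions agree**: for a `LogAtlas` (compatibility stated
elementwise, `LogAtlas.chart_compatible`: associated germs) any two charts through `x` have the
same stalk monoid `𝒪^×_{X,x} · φ_i(P_i) = 𝒪^×_{X,x} · φ_j(P_j)` (`chartStalkMonoid`, the
compatibility field of `LogRegularAtlas`). [cite: Kato1994, (1.5)–(1.6)] -/
theorem LogAtlas.chartStalkMonoid_eq (𝒜 : LogAtlas.{w} X) (i j : 𝒜.ι) (x : X) (hi : x ∈ 𝒜.U i)
    (hj : x ∈ 𝒜.U j) :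
    chartStalkMonoid (𝒜.U i) (𝒜.chart i) x hi = chartStalkMonoid (𝒜.U j) (𝒜.chart j) x hj := by
  apply le_antisymm
  · refine chartStalkMonoid_le_of_forall_associated _ _ x hi hj fun p => ?_
    obtain ⟨q, hq⟩ := 𝒜.chart_compatible i j x hi hj (Multiplicative.toAdd p)
    exact ⟨Multiplicative.ofAdd q, hq⟩
  · refine chartStalkMonoid_le_of_forall_associated _ _ x hj hi fun p => ?_
    obtain ⟨q, hq⟩ := 𝒜.chart_compatible j i x hj hi (Multiplicative.toAdd p)
    exact ⟨Multiplicative.ofAdd q, hq⟩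

end StalkMonoid

/-! ## From `LogRegularAtlas` to `LogAtlas` -/

section ToLogAtlas

variable {X : Scheme.{u}}

/-- Restriction along `U ≤ U` is the identity on sections. [cite: Kato1994, (1.5)] -/
private theorem presheaf_map_homOfLE_refl_apply' {U : X.Opens} (h : U ≤ U) (s : Γ(X, U)) :
    (X.presheaf.map (homOfLE h).op).hom s = s := by
  have : (homOfLE h).op = 𝟙 _ := rfl
  rw [this, X.presheaf.map_id]
  rfl

/-- **A `LogRegularAtlas` is a log regular `LogAtlas`**: a scheme with a `LogRegularAtlas`
underlies a log regular scheme in the sense of `LogRegularScheme.lean` (`Scheme.IsLogRegular`: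
some finite fs Zariski atlas `𝒜 : LogAtlas X` with `𝒜.IsLogRegular`). The atlas has the same
charts (Kato's (S) of (1.5) with (2.1) everywhere): the affine chart domains cover `X`,
saturation is `AddSubmonoid.NSMulSaturated`, the equality of stalk monoids gives the elementwise
compatibility (`exists_associated_of_chartStalkMonoid_le`), `X` is locally Noetherian (Noetherian
affine cover) and Kato's (2.1) at a point of a chart is `LogChart.IsLogRegularAt` at its prime
(`LogAtlas.isLogRegularLocal_stalkChart_iff`). [cite: Kato1994, (1.5) and Def. (2.1)] -/
theorem LogRegularAtlas.isLogRegular_scheme (ℬ : LogRegularAtlas X) : Scheme.IsLogRegular X := by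
  let 𝒜 : LogAtlas.{0} X :=
    { ι := ℬ.ι
      finite_index := ℬ.finite
      U := fun i => (ℬ.U i : X.Opens)
      exists_mem := fun x => Opens.mem_iSup.mp (by rw [ℬ.iSup_eq_top]; trivial)
      rk := ℬ.n
      P := ℬ.P
      fg := ℬ.fg
      saturated := fun i k v hkv =>
        (Nat.eq_zero_or_pos k).imp id fun hk => ℬ.saturated i v k hk hkv
      span_eq_top := ℬ.span_eq_top
      chart := ℬ.φ
      chart_compatible := fun i j x hi hj p => by
        obtain ⟨q, hq⟩ := exists_associated_of_chartStalkMonoid_le (ℬ.φ i) (ℬ.φ j) x hi hj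
          (ℬ.compat i j x hi hj).le (Multiplicative.ofAdd p)
        exact ⟨Multiplicative.toAdd q, hq⟩ }
  have h𝒜 : 𝒜.IsLogRegular := by
    refine ⟨isLocallyNoetherian_of_affine_cover ℬ.iSup_eq_top ℬ.isNoetherianRing,
      fun i x hx => ?_⟩
    refine (𝒜.isLogRegularLocal_stalkChart_iff i (ℬ.U i).2 le_rfl x hx).2 ?_
    have hcomp : (X.presheaf.map (homOfLE (le_refl ((ℬ.U i : X.Opens)))).op).hom.toMonoidHom.comp
        (𝒜.chart i) = ℬ.φ i :=
      MonoidHom.ext fun p => presheaf_map_homOfLE_refl_apply' _ _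
    -- transport log regularity of `ℬ.φ i` along `hcomp`
    have key : ∀ ψ : Multiplicative (ℬ.P i) →* Γ(X, (ℬ.U i : X.Opens)), ψ = ℬ.φ i →
        LogChart.IsLogRegularAt (ℬ.P i) ψ ((ℬ.U i).2.primeIdealOf ⟨x, hx⟩).asIdeal := by
      rintro ψ rfl
      exact ℬ.isLogRegularAt i _
    exact key _ hcomp
  exact h𝒜.isLogRegular_scheme

/-- A scheme with a `LogRegularAtlas` is quasi-compact (finitely many affine charts cover it).
[cite: Kato1994, (1.5) and (10.4)] -/
theorem LogRegularAtlas.compactSpace (ℬ : LogRegularAtlas X) : CompactSpace X := by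
  haveI := ℬ.finite
  refine ⟨?_⟩
  have hcov : (Set.univ : Set X) = ⋃ i, ((ℬ.U i : X.Opens) : Set X) := by
    have := congrArg (fun V : X.Opens => (V : Set X)) ℬ.iSup_eq_top
    simp only [Opens.coe_iSup, Opens.coe_top] at this
    exact this.symm
  rw [hcov]
  exact isCompact_iUnion fun i => (ℬ.U i).2.isCompact

end ToLogAtlas

/-! ## From a log regular `LogAtlas` on a quasi-compact scheme to a `LogRegularAtlas` -/

section ToLogRegularAtlas

variable {X : Scheme.{u}}

/-- On an affine open, every prime ideal of the ring of sections is the prime of a point.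
[cite: Kato1994, (1.5)] -/
private theorem exists_primeIdealOf_eq {V : X.Opens} (hV : IsAffineOpen V) (𝔭 : Ideal Γ(X, V))
    [𝔭.IsPrime] : ∃ y : V, hV.primeIdealOf y = ⟨𝔭, inferInstance⟩ :=
  ⟨⟨hV.fromSpec ⟨𝔭, inferInstance⟩, hV.range_fromSpec.le ⟨_, rfl⟩⟩, by
    apply hV.fromSpec.isOpenEmbedding.injective
    rw [hV.fromSpec_primeIdealOf]⟩

/-- **A log regular `LogAtlas` on a quasi-compact scheme gives a `LogRegularAtlas`** (Kato's (S)
with (2.1) everywhere, in the rendering of `LogRegularAtlas.lean`): prescribe the stalk monoids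
of the given charts (well defined by `LogAtlas.chartStalkMonoid_eq`), restrict each chart to
affine open neighbourhoods of the points of its domain — log regular at every prime of the
affine ring because primes are points and the stalk condition is `LogChart.IsLogRegularAt`
there (`LogAtlas.isLogRegularLocal_stalkChart_iff`) — and glue finitely many of these local
charts (`logRegularAtlas_of_localLogRegularChart`). [cite: Kato1994, (1.5) and Def. (2.1)] -/
theorem LogAtlas.IsLogRegular.nonempty_logRegularAtlas [CompactSpace X] {𝒜 : LogAtlas.{w} X}
    (h : 𝒜.IsLogRegular) : Nonempty (LogRegularAtlas X) := by
  haveI := h.isLocallyNoetherian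
  choose i hi using 𝒜.exists_mem
  let M : ∀ x : X, Submonoid (X.presheaf.stalk x) := fun x =>
    chartStalkMonoid (𝒜.U (i x)) (𝒜.chart (i x)) x (hi x)
  refine logRegularAtlas_of_localLogRegularChart X M fun x => ?_
  obtain ⟨V, hV, hxV, hVU⟩ := exists_isAffineOpen_mem_and_subset (hi x)
  replace hVU : V ≤ 𝒜.U (i x) := hVU
  refine ⟨{ U := ⟨V, hV⟩
            mem := hxV
            n := 𝒜.rk (i x)
            P := 𝒜.P (i x)
            φ := (X.presheaf.map (homOfLE hVU).op).hom.toMonoidHom.comp (𝒜.chart (i x))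
            fg := 𝒜.fg _
            saturated := 𝒜.saturated' (i x)
            span_eq_top := 𝒜.span_eq_top _
            isLogRegularAt := fun 𝔭 _ => ?_
            chartStalkMonoid_eq := fun y hy => ?_ }⟩
  · obtain ⟨y, hy⟩ := exists_primeIdealOf_eq hV 𝔭
    have key := (𝒜.isLogRegularLocal_stalkChart_iff (i x) hV hVU y.1 y.2).1
      (h.isLogRegularLocal (i x) y.1 (hVU y.2))
    rw [hy] at key
    exact key
  · change chartStalkMonoid V _ y hy = chartStalkMonoid (𝒜.U (i y)) (𝒜.chart (i y)) y (hi y)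
    rw [chartStalkMonoid_comp_map]
    exact 𝒜.chartStalkMonoid_eq (i x) (i y) y _ _

/-- **The two renderings agree**: a scheme carries a `LogRegularAtlas` iff it is quasi-compact
and underlies a log regular scheme in the sense of `LogRegularScheme.lean`.
[cite: Kato1994, (1.5) and Def. (2.1)] -/
theorem nonempty_logRegularAtlas_iff (X : Scheme.{u}) :
    Nonempty (LogRegularAtlas X) ↔ CompactSpace X ∧ Scheme.IsLogRegular X := by
  constructor
  · rintro ⟨ℬ⟩
    exact ⟨ℬ.compactSpace, ℬ.isLogRegular_scheme⟩
  · rintro ⟨hc, 𝒜, h𝒜⟩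
    exact h𝒜.nonempty_logRegularAtlas

end ToLogRegularAtlas

/-! ## The two vendored forms of Kato (10.4) are equivalent -/

section Kato

/-- `Kato1994_logRegularScheme_hasResolution` (several Zariski charts, `LogAtlas` rendering,
`LogRegularScheme.lean`) implies `Kato1994_logRegular_hasResolution_general` (`LogRegularAtlas`
rendering, `LogRegularAtlas.lean`). [cite: Kato1994, (10.4) with (9.8), (9.11), (10.3)] -/
theorem Kato1994_logRegular_hasResolution_general_of_scheme
    (h : Kato1994_logRegularScheme_hasResolution.{u}) :
    Kato1994_logRegular_hasResolution_general.{u} := by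
  rintro X ⟨ℬ⟩
  haveI := ℬ.compactSpace
  exact h.hasResolution ℬ.isLogRegular_scheme

/-- `Kato1994_logRegular_hasResolution_general` implies `Kato1994_logRegularScheme_hasResolution`.
[cite: Kato1994, (10.4) with (9.8), (9.11), (10.3)] -/
theorem Kato1994_logRegularScheme_hasResolution_of_general
    (h : Kato1994_logRegular_hasResolution_general.{u}) :
    Kato1994_logRegularScheme_hasResolution.{u} := by
  intro X 𝒜 hc h𝒜
  haveI := hc
  exact h X h𝒜.nonempty_logRegularAtlas

/-- **The two vendored several-charts forms of Kato 1994 (10.4) are equivalent named facts.**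
[cite: Kato1994, (10.4) with (9.8), (9.11), (10.3)] [cite: Niziol2006, Thm. 5.8] -/
theorem Kato1994_logRegularScheme_hasResolution_iff_general :
    Kato1994_logRegularScheme_hasResolution.{u} ↔ Kato1994_logRegular_hasResolution_general.{u} :=
  ⟨Kato1994_logRegular_hasResolution_general_of_scheme,
    Kato1994_logRegularScheme_hasResolution_of_general⟩

/-- **`Kato1994_logRegularScheme_hasResolution` reduced to the chart statement** of
`Kato1994_logRegular_hasResolution_general_of_charts` (`BlowupResolutionChartGlue.lean`): per
`LogRegularAtlas`, compatible nonempty finite sets of chart monomials with regular blowup-algebra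
localizations. [cite: Kato1994, (10.4) with (9.8), (9.11), (10.3)] [cite: Niziol2006, Thm. 5.8] -/
theorem Kato1994_logRegularScheme_hasResolution_of_charts
    (H : ∀ (X : Scheme.{u}) (𝒜 : LogRegularAtlas X), ∃ s : ∀ i, Finset (𝒜.P i),
      (∀ i, (s i).Nonempty) ∧
      (∀ (i j : 𝒜.ι) (y : X) (hi : y ∈ (𝒜.U i : X.Opens)) (hj : y ∈ (𝒜.U j : X.Opens)),
        (Ideal.span ((fun p : 𝒜.P i => 𝒜.φ i (Multiplicative.ofAdd p)) '' (s i : Set (𝒜.P i)))).map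
            (X.presheaf.germ (𝒜.U i : X.Opens) y hi).hom =
          (Ideal.span ((fun p : 𝒜.P j => 𝒜.φ j (Multiplicative.ofAdd p)) '' (s j : Set (𝒜.P j)))).map
            (X.presheaf.germ (𝒜.U j : X.Opens) y hj).hom) ∧
      (∀ i, ∀ a ∈ s i, ∀ (𝔓 : Ideal (blowupAlgebra
          (Ideal.span ((fun p : 𝒜.P i => 𝒜.φ i (Multiplicative.ofAdd p)) '' (s i : Set (𝒜.P i))))
          (𝒜.φ i (Multiplicative.ofAdd a)))) [𝔓.IsPrime],
        IsRegularLocalRing (Localization.AtPrime 𝔓))) :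
    Kato1994_logRegularScheme_hasResolution.{u} :=
  Kato1994_logRegularScheme_hasResolution_of_general
    (Kato1994_logRegular_hasResolution_general_of_charts H)

end Kato

end Literature.AlgebraicGeometry.Resolution

end
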